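/-
Copyright (c) 2026 the pub-hodgecm-mathlib formalisation cell (harness21).  Prover seat hodgecm-mathlib-K2E1-p14 (g2) (R90-TF S8 «U(Φ₃) χ-TWIN», TWIN-DAG row 7b feeder;
R90-CS-plan (g2) S8-R17 (7)), Track B «K2-LIT» ENGINE E1, h413 = `stmt-HodgeConjecture-24833`, route `HCCMUnconditional`: the Weyl symmetry `s(z) = s(2 − z)` of the Hecke
symbol on the `(χ₁, χ₂)`-pair-sections of `U(J₃)` for a SELF-DUAL pair — the N = 3 twin of ★ `K2E1ChiSymbolWeylSymmetrySelfDualU2`.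
-/
import Summits.HodgeConjecture.HodgeConjecture.Theorems.K2E1ArchSphericalTypeSymbolWeylSymmetryU2   -- ★ FILE 1 (abstract, every rank): `symbol_symm_of_selfDual … (ρ₀ : ℂ)`
import Summits.HodgeConjecture.HodgeConjecture.Theorems.K2E1ChiIntertwinedSectionU3                 -- ★ p861904 row 4a (K2E1-p16): `isChiSectionPair_intertwinedCoeff_three`, `flatSectionU_intertwinedCoeff_three_eq`
import Literature.NumberTheory.Automorphic.UnitaryGroupCuspIntegralSiegelMajorant                   -- ★ `borelHeight_mul_of_mem_comap_standardMaximalCompactGL` (every rank)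
import HarnessLib

/-!
# S8 «U(Φ₃) χ-TWIN» — `K2E1ChiSymbolWeylSymmetrySelfDualU3`: FOR A SELF-DUAL PAIR `(χ₁, χ₂)` (`χ₁ʷ = χ₁`; the middle character is Weyl-fixed) THE HECKE SYMBOL ON THE
# `(χ₁, χ₂)`-PAIR-SECTIONS OF `U(J₃)` WITH RIGHT `(K′, ω)`-LAW SATISFIES `s(z) = s(2 − z)`, HENCE `hsymm : s(1 − it) = s(1 + it)` — the N = 3 twin of ★
# `K2E1ChiSymbolWeylSymmetrySelfDualU2` (`1 − z ↦ 2 − z`, `H^{z−1} ↦ H^{z−2}`, centre `½ ↦ 1`, letters' half-plane `{Re w > 1} ↦ {Re w > 2}`), modulo the same ONE visible letter `hMne` + the Fubini∕continuity letters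

Track B ∕ K2-LIT, crux h413 = `stmt-HodgeConjecture-24833`, route of record `HCCMUnconditional`; cell `hodgecm-mathlib`, R90-TF slab S8 (Rogawski 1990 §13.9; TWIN-DAG v1 of K2E1-p16 (g2),
row 7b feeder of `K2E1ChiConvDataLevelCMThree`).  THEOREMS ONLY (no `def`, no `instance`, no notation, no named-fact hypothesis, no `sorry`; default heartbeats); lane
`--supports stmt-HodgeConjecture-24833 --as helper` (count-neutral).  CLOSES NO SOCKET.  Generic quadratic datum `(F, E, c)` with `c² = 1`, `c ≠ 1`; rank `3`.
INDEXING CURRENCY (D-S8-3 ★ `K2E1CharacterEisensteinU3PairDefs`): sections are `(χ₁, χ₂)`-PAIR-sections (★ `IsChiSectionPair χ₁ χ₂ φ`: `φ(b g) = χ₁(b₀₀) χ₂(b₁₁) φ(g)`), `χ₁` a ★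
`HeckeCharacter E`, `χ₂` a continuous character of the `U(1)`-torus; the right `(K′, ω)`-law is carried as the BARE predicate `∀ g k, φ (g k) = ω k · φ g` (no section-space
submodule is posited here — a later `chiSectionSpacePair χ₁ χ₂ K′ ω` feeds these theorems through its membership lemma).  SELF-DUALITY of the pair is `reflectChar c χ₁ = χ₁`:
the long Weyl element sends `(χ₁, χ₂) ↦ (χ₁ʷ, χ₂)` with the middle character UNCHANGED (★ row 4a, audit1 (n2) dictionary `w(χ₁, χ₂) = (χ₁^{−c}, χ₂)`).

THE MATHEMATICS ([MoeglinWaldspurger1995, II.1.6–II.1.7, IV.1.10]; [Garrett2018, §2.8]; [Rogawski1990, §13.9 p. 229]).  On `U(J₃)`, `2ρ_B = 2`: the intertwined coefficient is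
`Φ_w := (M(w)φ)·H^{w−2}`, `∫_N f_w^φ(W v g) dν = f_{2−w}^{Φ_w}(g)` (★ `flatSectionU_intertwinedCoeff_three_eq`), and `Φ_w` is a `(χ₁ʷ, χ₂)`-pair-section (★
`isChiSectionPair_intertwinedCoeff_three`) = a `(χ₁, χ₂)`-pair-section for a self-dual pair (§1), with the same right `(K′, ω)`-law when `K′ ≤ K_U` (`H` is right-`K_U`-invariant,
★ `borelHeight_mul_of_mem_comap_standardMaximalCompactGL`).  Given a kernel `h` and an ENTIRE `s` with the symbol law `hR` on all such sections, ★ FILE 1's abstract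
`symbol_symm_of_selfDual` at `ρ₀ = 2` (`A_w = f_w^φ`, `A′_{2−w} = f_{2−w}^{Φ_w}`, `c ≡ 1`, `Ω = {Re w > 2} ∩ {M(w)φ(g) ≠ 0}`) gives `s(z) = s(2 − z)` from the Fubini letter `hint`
(`Re w > 2`: the `U(2,1)` Godement half-plane, where the CM pair discharges it), the continuity letter `hcontM` on `{Re w > 2}`, and THE ONE REAL LETTER `hMne : ∃ w₁, 2 < Re w₁ ∧ M(w₁)φ(g) ≠ 0`.
* §1 `isChiSectionPair_intertwinedCoeff_of_selfDual` (pair law of `Φ_w` for a self-dual pair), `intertwinedCoeff_mul_right_of_rightLaw` (its right `(K′, ω)`-law, `K′ ≤ K_U`).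
* §2 HEADS **`chi_symbol_symm_of_selfDual_three`** (`∀ z, s z = s (2 − z)`) and **`chi_symbol_hsymm_of_selfDual_three`** (`∀ t, s(1 − it) = s(1 + it)`).
HONEST LABEL: HC_CM is proved only modulo the 7 printed citations (2 remaining named inputs: hLiu418 = `stmt-HodgeConjecture-24832`, h413 = `stmt-HodgeConjecture-24833`) until rung 0
closes; this file asserts no named fact, is conditional by construction on the visible letters `hMne hint hcontM`, and closes no socket; count-neutral.

## References
* [MoeglinWaldspurger1995] C. Mœglin, J.-L. Waldspurger, *Spectral decomposition and Eisenstein series* (1995): II.1.6–II.1.7, IV.1.10.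
* [Garrett2018] P. Garrett, *Modern Analysis of Automorphic Forms by Example* (2018): §2.8.
* [Rogawski1990] J. D. Rogawski, *Automorphic Representations of Unitary Groups in Three Variables* (1990): §13.9 p. 229.
-/

set_option autoImplicit false
set_option linter.dupNamespace false -- the mandated namespace repeats `HodgeConjecture.HodgeConjecture`

noncomputable section

open MeasureTheory Measure NumberField Filter Topology Set Function
open scoped NNReal ENNReal MatrixGroups
open Literature.NumberTheory Literature.NumberTheory.Automorphic Literature.NumberTheory.Automorphic.UnitaryGroup AdelicGroupData
open Literature.NumberTheory.GaloisRepresentations (HeckeCharacter)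
open Literature.NumberTheory.Automorphic.Arthur2013.Leaves.TECR
open Summit.HodgeConjecture.HodgeConjecture.Cruxes.H413.K2E1BorelEisensteinU
open Summit.HodgeConjecture.HodgeConjecture.Cruxes.H413.K2E1CharacterEisensteinU2Defs
open Summit.HodgeConjecture.HodgeConjecture.Cruxes.H413.K2E1CharacterEisensteinU3PairDefs
open Summit.HodgeConjecture.HodgeConjecture.Cruxes.H413.K2E1ChiIntertwinedSectionU3 (isChiSectionPair_intertwinedCoeff_three flatSectionU_intertwinedCoeff_three_eq)
open Summit.HodgeConjecture.HodgeConjecture.Cruxes.H413.K2E1ArchSphericalTypeSymbolWeylSymmetryU2 (symbol_symm_of_selfDual)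

namespace Summit.HodgeConjecture.HodgeConjecture.Cruxes.H413.K2E1ChiSymbolWeylSymmetrySelfDualU3

variable {F E : Type} [Field F] [NumberField F] [Field E] [NumberField E] [Algebra F E] {c : E ≃ₐ[F] E}
  [MeasurableSpace (quasiSplit F E c 3).Adelic] [BorelSpace (quasiSplit F E c 3).Adelic]

/-! ## §1 For a self-dual pair the intertwined coefficient `M(z)φ·H^{z−2}` is again a `(χ₁, χ₂)`-pair-section with the same right `(K′, ω)`-law -/

/-- **`M(z)φ · H^{z−2}` IS A `(χ₁, χ₂)`-PAIR-SECTION FOR A SELF-DUAL PAIR**: it is a `(χ₁ʷ, χ₂)`-pair-section (★ row 4a `isChiSectionPair_intertwinedCoeff_three`) and `χ₁ʷ = χ₁`.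
[cite: MoeglinWaldspurger1995, II.1.6–II.1.7] [cite: Rogawski1990, §13.9 p. 229] -/
theorem isChiSectionPair_intertwinedCoeff_of_selfDual (hc : c * c = 1) (hc1 : c ≠ 1) (ν : Measure ↥(adelicUnipotent F E c 3)) [ν.IsHaarMeasure]
    {χ₁ : HeckeCharacter E} {χ₂ : ↥(TorusDict.torus c) →ₜ* ℂˣ} (hsd : reflectChar c χ₁ = χ₁)
    {φ : (quasiSplit F E c 3).Adelic → ℂ} (hφ : IsChiSectionPair χ₁ χ₂ φ) (hφm : Measurable φ) (z : ℂ) :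
    IsChiSectionPair χ₁ χ₂ (fun g : (quasiSplit F E c 3).Adelic =>
      (∫ v : ↥(adelicUnipotent F E c 3), flatSectionU φ z ((quasiSplit F E c 3).toAdelic (weylLongU (c : E →+* E) (rfl : (StdForm.antidiagonal 3).over E = (StdForm.antidiagonal 3).over E)) * ((v : (quasiSplit F E c 3).Adelic) * g)) ∂ν) * (((borelHeight g : ℝ) : ℂ) ^ (z - 2))) := by
  have h := isChiSectionPair_intertwinedCoeff_three hc hc1 ν hφ hφm z
  rw [hsd] at h
  exact h

omit [BorelSpace (quasiSplit F E c 3).Adelic] in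
/-- **THE RIGHT `(K′, ω)`-LAW PASSES TO `M(z)φ · H^{z−2}`** for `K′ ≤ K_U`: `f_z^φ(y k) = ω(k) f_z^φ(y)` (`H` right-`K_U`-invariant, ★ `borelHeight_mul_of_mem_comap_standardMaximalCompactGL`)
passes under the `N(𝔸)`-integral, and `H(g k) = H(g)`. [cite: MoeglinWaldspurger1995, II.1.6] [cite: Garrett2018, §2.8] -/
theorem intertwinedCoeff_mul_right_of_rightLaw (ν : Measure ↥(adelicUnipotent F E c 3))
    {K' : Subgroup (quasiSplit F E c 3).Adelic} {ω : ↥K' → ℂ} (hK'U : K' ≤ ((standardMaximalCompactGL 3 E).comap (adelicVal F E c 3 ((StdForm.antidiagonal 3).over E)) : Subgroup (quasiSplit F E c 3).Adelic))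
    {φ : (quasiSplit F E c 3).Adelic → ℂ} (hφK : ∀ (g : (quasiSplit F E c 3).Adelic) (k : ↥K'), φ (g * k) = ω k * φ g) (z : ℂ) (g : (quasiSplit F E c 3).Adelic) (k : ↥K') :
    (fun g : (quasiSplit F E c 3).Adelic => (∫ v : ↥(adelicUnipotent F E c 3), flatSectionU φ z ((quasiSplit F E c 3).toAdelic (weylLongU (c : E →+* E) (rfl : (StdForm.antidiagonal 3).over E = (StdForm.antidiagonal 3).over E)) * ((v : (quasiSplit F E c 3).Adelic) * g)) ∂ν) * (((borelHeight g : ℝ) : ℂ) ^ (z - 2))) (g * k) =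
      ω k * (fun g : (quasiSplit F E c 3).Adelic => (∫ v : ↥(adelicUnipotent F E c 3), flatSectionU φ z ((quasiSplit F E c 3).toAdelic (weylLongU (c : E →+* E) (rfl : (StdForm.antidiagonal 3).over E = (StdForm.antidiagonal 3).over E)) * ((v : (quasiSplit F E c 3).Adelic) * g)) ∂ν) * (((borelHeight g : ℝ) : ℂ) ^ (z - 2))) g := by
  have hkU : (k : (quasiSplit F E c 3).Adelic) ∈ ((standardMaximalCompactGL 3 E).comap (adelicVal F E c 3 ((StdForm.antidiagonal 3).over E)) : Subgroup (quasiSplit F E c 3).Adelic) := hK'U k.2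
  have hint : ∀ v : ↥(adelicUnipotent F E c 3),
      flatSectionU φ z ((quasiSplit F E c 3).toAdelic (weylLongU (c : E →+* E) (rfl : (StdForm.antidiagonal 3).over E = (StdForm.antidiagonal 3).over E)) * ((v : (quasiSplit F E c 3).Adelic) * (g * (k : (quasiSplit F E c 3).Adelic)))) = ω k * flatSectionU φ z ((quasiSplit F E c 3).toAdelic (weylLongU (c : E →+* E) (rfl : (StdForm.antidiagonal 3).over E = (StdForm.antidiagonal 3).over E)) * ((v : (quasiSplit F E c 3).Adelic) * g)) := fun v => by
    rw [flatSectionU_apply, flatSectionU_apply, ← mul_assoc ((v : (quasiSplit F E c 3).Adelic)), ← mul_assoc _ (↑v * g), hφK _ k,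
      borelHeight_mul_of_mem_comap_standardMaximalCompactGL hkU, mul_assoc]
  dsimp only
  rw [integral_congr_ae (Eventually.of_forall hint), integral_const_mul, borelHeight_mul_of_mem_comap_standardMaximalCompactGL hkU, mul_assoc]

/-! ## §2 The Weyl symmetry of the symbol for a self-dual pair: `s(z) = s(2 − z)` -/

/-- **`s(z) = s(2 − z)` FOR A SELF-DUAL PAIR** (`χ₁ʷ = χ₁`): `φ` a measurable `(χ₁, χ₂)`-pair-section with right `(K′, ω)`-law, `K′ ≤ K_U`, the symbol law `hR` on ALL such sections for a kernel `h`
and an ENTIRE `s`, the Fubini letter `hint` and the continuity letter `hcontM` on `{Re w > 2}` (the `U(2,1)` Godement half-plane, `2ρ_B = 2`) at a base point `g`, and the LETTER `hMne` (`M(w₁)φ(g) ≠ 0` for one `Re w₁ > 2`) ⇒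
`∀ z, s z = s (2 − z)` — ★ FILE 1 `symbol_symm_of_selfDual` at `ρ₀ = 2` with `A_w = f_w^φ`, `A′_{2−w} = f_{2−w}^{Φ_w}`, `c ≡ 1` (★ row 4a), `Ω = {Re w > 2} ∩ {M(w)φ(g) ≠ 0}`.
[cite: MoeglinWaldspurger1995, IV.1.10] [cite: Garrett2018, §2.8] -/
theorem chi_symbol_symm_of_selfDual_three (hc : c * c = 1) (hc1 : c ≠ 1) (νG : Measure (quasiSplit F E c 3).Adelic) [SFinite νG]
    (ν : Measure ↥(adelicUnipotent F E c 3)) [ν.IsHaarMeasure] [SFinite ν]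
    {χ₁ : HeckeCharacter E} {χ₂ : ↥(TorusDict.torus c) →ₜ* ℂˣ} (hsd : reflectChar c χ₁ = χ₁) {K' : Subgroup (quasiSplit F E c 3).Adelic} {ω : ↥K' → ℂ} (hK'U : K' ≤ ((standardMaximalCompactGL 3 E).comap (adelicVal F E c 3 ((StdForm.antidiagonal 3).over E)) : Subgroup (quasiSplit F E c 3).Adelic))
    {φ : (quasiSplit F E c 3).Adelic → ℂ} (hφ : IsChiSectionPair χ₁ χ₂ φ) (hφK : ∀ (g : (quasiSplit F E c 3).Adelic) (k : ↥K'), φ (g * k) = ω k * φ g) (hφm : Measurable φ)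
    (h : (quasiSplit F E c 3).Adelic → ℂ) (s : ℂ → ℂ) (hs : Differentiable ℂ s)
    (hR : ∀ (z : ℂ) (ψ : (quasiSplit F E c 3).Adelic → ℂ), IsChiSectionPair χ₁ χ₂ ψ → (∀ (g : (quasiSplit F E c 3).Adelic) (k : ↥K'), ψ (g * k) = ω k * ψ g) →
      ∀ x : (quasiSplit F E c 3).Adelic, ∫ y, h y * flatSectionU ψ z (x * y) ∂νG = s z * flatSectionU ψ z x)
    (g : (quasiSplit F E c 3).Adelic)
    (hint : ∀ w : ℂ, 2 < w.re → Integrable (uncurry fun (y : (quasiSplit F E c 3).Adelic) (v : ↥(adelicUnipotent F E c 3)) => h y * flatSectionU φ w ((quasiSplit F E c 3).toAdelic (weylLongU (c : E →+* E) (rfl : (StdForm.antidiagonal 3).over E = (StdForm.antidiagonal 3).over E)) * (v : (quasiSplit F E c 3).Adelic) * (g * y))) (νG.prod ν))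
    (hcontM : ContinuousOn (fun w : ℂ => ∫ v : ↥(adelicUnipotent F E c 3), flatSectionU φ w ((quasiSplit F E c 3).toAdelic (weylLongU (c : E →+* E) (rfl : (StdForm.antidiagonal 3).over E = (StdForm.antidiagonal 3).over E)) * ((v : (quasiSplit F E c 3).Adelic) * g)) ∂ν) {w : ℂ | 2 < w.re})
    (hMne : ∃ w₁ : ℂ, 2 < w₁.re ∧ ∫ v : ↥(adelicUnipotent F E c 3), flatSectionU φ w₁ ((quasiSplit F E c 3).toAdelic (weylLongU (c : E →+* E) (rfl : (StdForm.antidiagonal 3).over E = (StdForm.antidiagonal 3).over E)) * ((v : (quasiSplit F E c 3).Adelic) * g)) ∂ν ≠ 0) (z : ℂ) :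
    s z = s (2 - z) := by
  set W : (quasiSplit F E c 3).Adelic := (quasiSplit F E c 3).toAdelic (weylLongU (c : E →+* E) (rfl : (StdForm.antidiagonal 3).over E = (StdForm.antidiagonal 3).over E)) with hW
  -- the intertwined coefficient `M(w)φ·H^{w−2}` and the two section families
  set Φ : ℂ → (quasiSplit F E c 3).Adelic → ℂ := fun w x => (∫ v : ↥(adelicUnipotent F E c 3), flatSectionU φ w (W * ((v : (quasiSplit F E c 3).Adelic) * x)) ∂ν) * (((borelHeight x : ℝ) : ℂ) ^ (w - 2)) with hΦ
  have hΦV : ∀ w, IsChiSectionPair χ₁ χ₂ (Φ w) := fun w => isChiSectionPair_intertwinedCoeff_of_selfDual hc hc1 ν hsd hφ hφm w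
  have hΦK : ∀ w (x : (quasiSplit F E c 3).Adelic) (k : ↥K'), Φ w (x * k) = ω k * Φ w x := fun w x k => intertwinedCoeff_mul_right_of_rightLaw ν hK'U hφK w x k
  have hrefl : ∀ w x, ∫ v : ↥(adelicUnipotent F E c 3), flatSectionU φ w (W * (v : (quasiSplit F E c 3).Adelic) * x) ∂ν = flatSectionU (Φ w) (2 - w) x := fun w x =>
    flatSectionU_intertwinedCoeff_three_eq ν φ w x
  set A : ℂ → (quasiSplit F E c 3).Adelic → ℂ := fun w => flatSectionU φ w with hA
  set A' : ℂ → (quasiSplit F E c 3).Adelic → ℂ := fun u => flatSectionU (Φ (2 - u)) u with hA'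
  have hA'w : ∀ w, A' (2 - w) = flatSectionU (Φ w) (2 - w) := fun w => by rw [hA']; simp only [sub_sub_cancel]
  -- the good open set
  set Ω : Set ℂ := {w : ℂ | 2 < w.re} ∩ (fun w : ℂ => ∫ v : ↥(adelicUnipotent F E c 3), flatSectionU φ w (W * ((v : (quasiSplit F E c 3).Adelic) * g)) ∂ν) ⁻¹' {0}ᶜ with hΩ
  have hΩo : IsOpen Ω := hcontM.isOpen_inter_preimage (isOpen_lt continuous_const Complex.continuous_re) isOpen_compl_singleton
  obtain ⟨w₁, hw₁, hw₁ne⟩ := hMne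
  have h0 : ∃ w₁ ∈ Ω, (fun _ : ℂ => (1 : ℂ)) w₁ ≠ 0 := ⟨w₁, ⟨hw₁, hw₁ne⟩, one_ne_zero⟩
  refine symbol_symm_of_selfDual νG ν (fun v : ↥(adelicUnipotent F E c 3) => (v : (quasiSplit F E c 3).Adelic)) W g h A A' s (fun _ => (1 : ℂ)) 2 hs hΩo
    continuousOn_const h0 ?_ ?_ ?_ ?_ ?_ z
  · -- hR on the `(χ₁, χ₂)`-pair-sections
    intro w _ x
    exact hR w φ hφ hφK x
  · -- hR′ at the reflected section (again a `(χ₁, χ₂)`-pair-section with the same right law)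
    intro w _ x
    rw [hA'w]
    exact hR (2 - w) (Φ w) (hΦV w) (hΦK w) x
  · -- hscale with c ≡ 1 (★ row 4a)
    intro w _ x
    rw [one_mul, hA'w]
    exact hrefl w x
  · -- Fubini letter
    intro w hw
    have e : (uncurry fun (y : (quasiSplit F E c 3).Adelic) (v : ↥(adelicUnipotent F E c 3)) => h y * A w (W * (v : (quasiSplit F E c 3).Adelic) * (g * y))) =
        uncurry fun (y : (quasiSplit F E c 3).Adelic) (v : ↥(adelicUnipotent F E c 3)) => h y * flatSectionU φ w (W * (v : (quasiSplit F E c 3).Adelic) * (g * y)) := rfl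
    rw [e]
    exact hint w hw.1
  · -- hA′: the intertwined section does not vanish at `g` on `Ω`
    intro w hw
    rw [hA'w, ← hrefl w g]
    have hw2 : (∫ v : ↥(adelicUnipotent F E c 3), flatSectionU φ w (W * ((v : (quasiSplit F E c 3).Adelic) * g)) ∂ν) ≠ 0 := hw.2
    simpa only [mul_assoc] using hw2

/-- **`hsymm` FOR A SELF-DUAL PAIR** — the N = 3 byte shape `∀ t, s(1 − it) = s(1 + it)` (centre `z = 1`; §2 at `z = 1 + it`: `2 − (1 + it) = 1 − it`).
[cite: MoeglinWaldspurger1995, IV.1.10] [cite: Garrett2018, §2.8] -/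
theorem chi_symbol_hsymm_of_selfDual_three (hc : c * c = 1) (hc1 : c ≠ 1) (νG : Measure (quasiSplit F E c 3).Adelic) [SFinite νG]
    (ν : Measure ↥(adelicUnipotent F E c 3)) [ν.IsHaarMeasure] [SFinite ν]
    {χ₁ : HeckeCharacter E} {χ₂ : ↥(TorusDict.torus c) →ₜ* ℂˣ} (hsd : reflectChar c χ₁ = χ₁) {K' : Subgroup (quasiSplit F E c 3).Adelic} {ω : ↥K' → ℂ} (hK'U : K' ≤ ((standardMaximalCompactGL 3 E).comap (adelicVal F E c 3 ((StdForm.antidiagonal 3).over E)) : Subgroup (quasiSplit F E c 3).Adelic))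
    {φ : (quasiSplit F E c 3).Adelic → ℂ} (hφ : IsChiSectionPair χ₁ χ₂ φ) (hφK : ∀ (g : (quasiSplit F E c 3).Adelic) (k : ↥K'), φ (g * k) = ω k * φ g) (hφm : Measurable φ)
    (h : (quasiSplit F E c 3).Adelic → ℂ) (s : ℂ → ℂ) (hs : Differentiable ℂ s)
    (hR : ∀ (z : ℂ) (ψ : (quasiSplit F E c 3).Adelic → ℂ), IsChiSectionPair χ₁ χ₂ ψ → (∀ (g : (quasiSplit F E c 3).Adelic) (k : ↥K'), ψ (g * k) = ω k * ψ g) →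
      ∀ x : (quasiSplit F E c 3).Adelic, ∫ y, h y * flatSectionU ψ z (x * y) ∂νG = s z * flatSectionU ψ z x)
    (g : (quasiSplit F E c 3).Adelic)
    (hint : ∀ w : ℂ, 2 < w.re → Integrable (uncurry fun (y : (quasiSplit F E c 3).Adelic) (v : ↥(adelicUnipotent F E c 3)) => h y * flatSectionU φ w ((quasiSplit F E c 3).toAdelic (weylLongU (c : E →+* E) (rfl : (StdForm.antidiagonal 3).over E = (StdForm.antidiagonal 3).over E)) * (v : (quasiSplit F E c 3).Adelic) * (g * y))) (νG.prod ν))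
    (hcontM : ContinuousOn (fun w : ℂ => ∫ v : ↥(adelicUnipotent F E c 3), flatSectionU φ w ((quasiSplit F E c 3).toAdelic (weylLongU (c : E →+* E) (rfl : (StdForm.antidiagonal 3).over E = (StdForm.antidiagonal 3).over E)) * ((v : (quasiSplit F E c 3).Adelic) * g)) ∂ν) {w : ℂ | 2 < w.re})
    (hMne : ∃ w₁ : ℂ, 2 < w₁.re ∧ ∫ v : ↥(adelicUnipotent F E c 3), flatSectionU φ w₁ ((quasiSplit F E c 3).toAdelic (weylLongU (c : E →+* E) (rfl : (StdForm.antidiagonal 3).over E = (StdForm.antidiagonal 3).over E)) * ((v : (quasiSplit F E c 3).Adelic) * g)) ∂ν ≠ 0) (t : ℝ) :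
    s (1 - t * Complex.I) = s (1 + t * Complex.I) := by
  have h1 := chi_symbol_symm_of_selfDual_three hc hc1 νG ν hsd hK'U hφ hφK hφm h s hs hR g hint hcontM hMne (1 + t * Complex.I)
  rw [h1]
  congr 1
  ring

end Summit.HodgeConjecture.HodgeConjecture.Cruxes.H413.K2E1ChiSymbolWeylSymmetrySelfDualU3

end
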